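import Literature.Barriers.CriticalPhenomena.PlaquetteWalkHoleRootStructuralKill
import Literature.Probability.RandomPlanarGeometry.YangBaxterSAWHexDictionarySignedWinding
import HarnessLib

/-!
# Barrier catalogue (SAWScalingLimit): a WOUND excursion STRADDLES the root row — it draws arcs strictly above and strictly
below the row of the hole, west of the root («WOUND STRADDLE»)

Setting of the lane's hole-root files: a finite face domain `D`, a rhombus `w` whose `W` side `a = w.side W` is a non-interior
root (a hole root when the western neighbour of `w` is absent), a rhombus `r ∈ D` and a Glazman–Manolescu walk `ω` from `a` of class
`B2a` at `r` (first visit, excursion, return). «Wound» = the excursion polygon winds about the midpoint of the root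
(`ω.AJ ≠ 0`; by `YangBaxterSAWExcursionJordan` ⟺ an ODD number of excursion mid-edges on the lattice half-line behind the root,
the bottom line of the hole row running west).

* `exists_exit_eq_rayMid_of_odd` — an odd ray count produces an excursion exit mid-edge ON the ray;
* `exists_fc_row_of_exit_slant` — a slanted excursion mid-edge `slant x y` forces an ARC of the walk in a plaquette of row `y − 1`
  and one in a plaquette of row `y` (the two plaquettes at that edge; at the last mid-edge the plaquette `r` itself supplies one);
* ★ `exists_fc_below_of_wound` — **a wound walk draws an arc in a plaquette of the row BELOW the hole row, in a column west of the
  root** (`(fc i).2 = w.2 − 1`, `(fc i).1 ≤ w.1 − 1`);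
* the ROW REFLECTION at a general cell: `mirrorAt` (the reflected labelled walk in the reflected domain `rowMirrorDom w D`, same
  root), `isB2a_mirrorAt`, `WE_mirrorAt` (`WE'(θ) = −WE(π − θ)`), `firstSideG_mirrorAt`, `z1_mirrorAt`, ★ `AJ_mirrorAt_ne_zero`
  (woundness is preserved — through `WE − excursionWinding = 2·AJ` of `YangBaxterSAWHexDictionarySignedWinding` and the oddness of
  the excursion-winding table under the reflection), generalising `PlaquetteWalkHoleRootStructuralKill`'s far-cell transport `mirrorFar`;
* ★ `exists_fc_above_of_wound` — by reflection (`rayCountAt_W_of_mids_mirror` of `YangBaxterSAWHexDictionaryWinding`: the reflected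
  bottom ray is the TOP line of the hole row): **a wound walk also draws an arc in a plaquette of the row ABOVE the hole row**,
  west of the root;
* ★★ `wound_straddle` — both at once.

Use (venture lane «pcv-sawmu», DESIGN-next b-engine-1 g23 §2.1): the topological input of the «WOUND COST ≥ 5» programme (the
extreme rows of a wound walk are not the root row, so every run of the walk inside its topmost and bottommost rows begins and
ends with an isolated turn). [GlazmanManolescu2019, Lemma 2.1; Glazman 2015, Lemma 3.1; the even–odd rule]
-/

noncomputable section

namespace Literature.Probability.RandomPlanarGeometry.SAW.YangBaxter

open Real
open Literature.Barriers.CriticalPhenomena.PlaquetteWalk (mirrorRow mirrorRowFace mirrorSide mirrorArc mirrorRow_side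
  mirrorRowFace_mirrorRowFace mirrorRow_injective mirrorRowFace_injective mirrorSide_mirrorSide arcsOf_map_mirrorRow)
open Literature.Barriers.CriticalPhenomena.PlaquetteWalk.MirrorWalk (mirrorWalk)

open private fc_fh fc_ne fh_add_Mv three_le_Mv from Literature.Probability.RandomPlanarGeometry.YangBaxterSAWGeneralDomain
open private side_jOut from Literature.Probability.RandomPlanarGeometry.YangBaxterSAWExcursionJordan

/-! ## Which plaquettes have a given slanted side -/

/-- A slanted mid-edge `slant x y` is a side of exactly two plaquettes: the `S` side of `(x, y)` and the `N` side of `(x, y − 1)`.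
[cite: GlazmanManolescu2019, §1 (the tiling)] -/
theorem eq_of_side_eq_slant {f : Face} {s : Side} {x y : ℤ} (h : f.side s = .slant x y) :
    (f = (x, y) ∧ s = .S) ∨ (f = (x, y - 1) ∧ s = .N) := by
  obtain ⟨k, j⟩ := f
  cases s <;> simp [Face.side] at h ⊢
  · exact ⟨h.1, h.2⟩
  · refine ⟨h.1, by omega⟩

namespace ΩG

variable {D : Set Face} {w r : Face} (ω : ΩG D (w.side .W) r)

/-! ## From an odd ray count to an exit mid-edge on the ray, and to an arc in the adjacent row -/

open scoped Classical in
/-- An odd (hence non-zero) ray count exhibits an excursion exit mid-edge lying on the ray. [cite: CourantRobbins1958, Ch. V Appendix §2 (the even–odd rule)] -/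
theorem exists_exit_eq_rayMid_of_odd (hr : RootedFace D (w.side .W) r) (h : ω.IsB2a) {b : Face} {τ : Side}
    (hodd : Odd (ω.rayCountAt hr h b τ)) :
    ∃ j < ω.Mv, ∃ m : ℕ, (ω.jFace h j).side (ω.jOut hr h j) = rayMid b τ m := by
  have hne : ω.rayCountAt hr h b τ ≠ 0 := fun e => by rw [e] at hodd; exact (Nat.not_odd_zero hodd).elim
  unfold rayCountAt at hne
  obtain ⟨j, hj⟩ := Finset.card_ne_zero.1 hne
  rw [Finset.mem_filter, Finset.mem_range] at hj
  exact ⟨j, hj.1, hj.2⟩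

/-- **An excursion exit mid-edge that is slanted, `slant x y`, forces arcs of the walk in BOTH adjacent rows `y − 1` and `y`**
(the arc before and the arc after the crossing lie in the two plaquettes at that edge; when the crossing is the return to `r`,
the rhombus `r` — which carries the first arc of the excursion's prefix — is one of them). [cite: GlazmanManolescu2019, §1 (Fig. 1: consecutive arcs lie in different rhombi)] -/
theorem exists_fc_row_of_exit_slant (hr : RootedFace D (w.side .W) r) (h : ω.IsB2a) {j : ℕ} (hj : j < ω.Mv) {x y : ℤ}
    (he : (ω.jFace h j).side (ω.jOut hr h j) = .slant x y) :
    (∃ i < ω.2.arcs.length, ω.2.fc i = (x, y - 1)) ∧ (∃ i < ω.2.arcs.length, ω.2.fc i = (x, y)) := by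
  have hFM : ω.2.firstHitG + ω.Mv = ω.2.arcs.length := fh_add_Mv h
  have hfr : ω.2.fc ω.2.firstHitG = r := (fc_fh ω hr h).1
  rw [side_jOut h hj] at he
  -- the mid-edge `nth (F + j + 1)`; the arc BEFORE it has index `F + j`
  set i := ω.2.firstHitG + j with hi
  have hi_lt : i < ω.2.arcs.length := by omega
  obtain ⟨-, hout⟩ := ω.2.side_sIn_eq_nth hi_lt
  rw [he] at hout
  -- the plaquette of arc `i` has `slant x y` as a side
  rcases eq_of_side_eq_slant hout with ⟨hf1, -⟩ | ⟨hf1, -⟩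
  · -- arc `i` lies in `(x, y)`; the other plaquette `(x, y-1)`: either arc `i+1` (if it exists) or `r` itself
    refine ⟨?_, ⟨i, hi_lt, hf1⟩⟩
    by_cases hlast : i + 1 < ω.2.arcs.length
    · obtain ⟨hin, -⟩ := ω.2.side_sIn_eq_nth hlast
      rw [he] at hin
      rcases eq_of_side_eq_slant hin with ⟨hf2, -⟩ | ⟨hf2, -⟩
      · exact absurd (hf1.trans hf2.symm) (ω.2.fc_succ_ne hlast)
      · exact ⟨i + 1, hlast, hf2⟩
    · -- the crossing is the last mid-edge: it is the return side of `r`, and `r ≠ fc i`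
      have hlen : i + 1 = ω.2.arcs.length := by omega
      have hz : ω.2.nth (i + 1) = r.side ω.1 := by rw [hlen]; exact ω.2.nth_length
      rw [he] at hz
      rcases eq_of_side_eq_slant hz.symm with ⟨hr1, -⟩ | ⟨hr1, -⟩
      · -- `r = (x, y) = fc i`: impossible, the last arc is outside `r` (class B2a, `j = Mv - 1 ≥ 1`)
        have hjpos : ω.2.firstHitG < i := by have := three_le_Mv hr h; omega
        exact absurd (hf1.trans hr1.symm) (fc_ne ω hr h hjpos hi_lt)
      · exact ⟨ω.2.firstHitG, ω.fh_lt h, hfr.trans hr1⟩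
  · refine ⟨⟨i, hi_lt, hf1⟩, ?_⟩
    by_cases hlast : i + 1 < ω.2.arcs.length
    · obtain ⟨hin, -⟩ := ω.2.side_sIn_eq_nth hlast
      rw [he] at hin
      rcases eq_of_side_eq_slant hin with ⟨hf2, -⟩ | ⟨hf2, -⟩
      · exact ⟨i + 1, hlast, hf2⟩
      · exact absurd (hf1.trans hf2.symm) (ω.2.fc_succ_ne hlast)
    · have hlen : i + 1 = ω.2.arcs.length := by omega
      have hz : ω.2.nth (i + 1) = r.side ω.1 := by rw [hlen]; exact ω.2.nth_length
      rw [he] at hz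
      rcases eq_of_side_eq_slant hz.symm with ⟨hr1, -⟩ | ⟨hr1, -⟩
      · exact ⟨ω.2.firstHitG, ω.fh_lt h, hfr.trans hr1⟩
      · have hjpos : ω.2.firstHitG < i := by have := three_le_Mv hr h; omega
        exact absurd (hf1.trans hr1.symm) (fc_ne ω hr h hjpos hi_lt)

/-- The ray edges behind the `W` side of a plaquette `b` are the slanted edges `slant (b.1 − 1 − m) b.2`.
[cite: CourantRobbins1958, Ch. V Appendix §2 (the even–odd rule)] -/
theorem rayMid_W_eq (b : Face) (m : ℕ) : rayMid b .W m = .slant (b.1 - 1 - m) b.2 := by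
  simp [rayMid, rayCell, raySide, Face.side]

/-- ★ **A WOUND WALK DRAWS AN ARC BELOW THE HOLE ROW, WEST OF THE ROOT** (and one in the hole row there): some plaquette of the
walk lies in row `w.2 − 1` and column `≤ w.1 − 1`. [cite: GlazmanManolescu2019, Lemma 2.1 (statement, "in the form given in [Gl]")] [cite: CourantRobbins1958, Ch. V Appendix §2 (the even–odd rule)] -/
theorem exists_fc_below_of_wound (hr : RootedFace D (w.side .W) r) (h : ω.IsB2a)
    (hA : ω.AJ hr h (toC (midPt (w.side .W))) ≠ 0) :
    ∃ i < ω.2.arcs.length, (ω.2.fc i).2 = w.2 - 1 ∧ (ω.2.fc i).1 ≤ w.1 - 1 := by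
  have hodd := (ω.AJ_root_ne_zero_iff_odd_rayCountAt (hr := hr) h (b := w) (τ := .W) rfl).1 hA
  obtain ⟨j, hj, m, he⟩ := ω.exists_exit_eq_rayMid_of_odd hr h hodd
  rw [rayMid_W_eq] at he
  obtain ⟨⟨i, hi, hf⟩, -⟩ := ω.exists_fc_row_of_exit_slant hr h hj he
  exact ⟨i, hi, by rw [hf], by rw [hf]; show w.1 - 1 - (m : ℤ) ≤ w.1 - 1; omega⟩

/-! ## The row reflection at a general cell -/

/-- The reflected rhombus from the same root: the reflected domain has it as a rooted face. [cite: GlazmanManolescu2019, §4.2 (lattice symmetries)] -/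
theorem rootedFace_rowMirrorDom_mirrorRowFace (hr : RootedFace D (w.side .W) r) :
    RootedFace (rowMirrorDom w D) (w.side .W) (mirrorRowFace w.2 r) := by
  refine ⟨by rw [mem_rowMirrorDom, mirrorRowFace_mirrorRowFace]; exact hr.mem, fun hh => hr.root ?_⟩
  obtain ⟨k, j⟩ := w
  simp only [Face.side, MidEdge.faces, mem_rowMirrorDom, mirrorRowFace] at hh ⊢
  have e : 2 * j - j = j := by ring
  rw [e] at hh
  exact hh

/-- **The reflected labelled walk at a general cell**: reflect every mid-edge in the root row; the root is fixed, the cell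
goes to its mirror image, the end side to the mirror side. [cite: GlazmanManolescu2019, §4.2 (lattice symmetries)] -/
def mirrorAt : ΩG (rowMirrorDom w D) (w.side .W) (mirrorRowFace w.2 r) :=
  ⟨mirrorSide ω.1, mirrorWalk w.2 (fun g hg => by rw [mem_rowMirrorDom, mirrorRowFace_mirrorRowFace]; exact hg)
    (mirrorRow_root w) (mirrorRow_side w.2 r ω.1) ω.2⟩

/-- Its mid-edges are the reflected mid-edges. [cite: GlazmanManolescu2019, §4.2 (lattice symmetries)] -/
theorem mirrorAt_mids : ω.mirrorAt.2.mids = ω.2.mids.map (mirrorRow w.2) := rfl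

/-- Its end side is the mirror side. [cite: GlazmanManolescu2019, §4.2 (lattice symmetries)] -/
theorem mirrorAt_fst : ω.mirrorAt.1 = mirrorSide ω.1 := rfl

variable {ω}

/-- The reflected walk of a class-`B2a` walk is of class `B2a`. [cite: Glazman2015WeightedSAW, Lemma 3.1 (proof, pp. 6–7)] -/
theorem isB2a_mirrorAt (hr : RootedFace D (w.side .W) r) (h : ω.IsB2a) : ω.mirrorAt.IsB2a :=
  isB2a_of_mids_mirror hr ω.mirrorAt_mids h

/-- Its first side is the mirror side. [cite: Glazman2015WeightedSAW, Lemma 3.1 (proof, pp. 6–7)] -/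
theorem firstSideG_mirrorAt (hr : RootedFace D (w.side .W) r) (h : ω.IsB2a) :
    ω.mirrorAt.2.firstSideG = mirrorSide ω.2.firstSideG := by
  have hr' := rootedFace_rowMirrorDom_mirrorRowFace (w := w) hr
  obtain ⟨-, hsIn, -⟩ := fc_fh ω hr h
  obtain ⟨-, hsIn', -⟩ := fc_fh ω.mirrorAt hr' (isB2a_mirrorAt hr h)
  have hF : ω.mirrorAt.2.firstHitG = ω.2.firstHitG := YBWalk.firstHitG_eq_of_mids_mirror ω.mirrorAt_mids
  obtain ⟨e1, -⟩ := YBWalk.sIn_sOut_eq_of_mids_mirror ω.mirrorAt_mids (i := ω.2.firstHitG) (ω.fh_lt h)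
  rw [← hsIn', hF, e1, hsIn]

/-- Its exit side is the mirror side. [cite: Glazman2015WeightedSAW, Lemma 3.1 (proof, pp. 6–7)] -/
theorem z1_mirrorAt (hr : RootedFace D (w.side .W) r) (h : ω.IsB2a) :
    ω.mirrorAt.z1 (rootedFace_rowMirrorDom_mirrorRowFace hr) (isB2a_mirrorAt hr h) = mirrorSide (ω.z1 hr h) := by
  have hr' := rootedFace_rowMirrorDom_mirrorRowFace (w := w) hr
  obtain ⟨-, -, hsOut⟩ := fc_fh ω hr h
  obtain ⟨-, -, hsOut'⟩ := fc_fh ω.mirrorAt hr' (isB2a_mirrorAt hr h)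
  have hF : ω.mirrorAt.2.firstHitG = ω.2.firstHitG := YBWalk.firstHitG_eq_of_mids_mirror ω.mirrorAt_mids
  obtain ⟨-, e2⟩ := YBWalk.sIn_sOut_eq_of_mids_mirror ω.mirrorAt_mids (i := ω.2.firstHitG) (ω.fh_lt h)
  show ω.mirrorAt.2.exitSideG hr' _ = mirrorSide (ω.2.exitSideG hr (ω.fh_lt h))
  rw [← hsOut', ← hsOut, hF, e2]

/-- **The excursion winding of the reflected walk at `θ` is minus that of the walk at `π − θ`.**
[cite: GlazmanManolescu2019, §2.1, eq. (2.1) (wind(γ)) and §1 (θ ↔ π − θ)] -/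
theorem WE_mirrorAt (θ : ℝ) : ω.mirrorAt.WE (fun _ => θ) = -ω.WE (fun _ => π - θ) := by
  unfold ΩG.WE
  rw [YBWalk.firstHitG_eq_of_mids_mirror ω.mirrorAt_mids]
  have harcs : ω.mirrorAt.2.arcs = ω.2.arcs.map (mirrorArc w.2) := by
    show arcsOf ω.mirrorAt.2.mids = _
    rw [mirrorAt_mids, arcsOf_map_mirrorRow]
  rw [harcs, ← List.map_drop, sum_map_arcTurnOf_mirrorArc]

/-- ★ **WOUNDNESS IS PRESERVED BY THE REFLECTION**: the excursion polygon of the reflected walk winds about the root iff the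
original does. [cite: GlazmanManolescu2019, Lemma 2.1 (statement, "in the form given in [Gl]") and §1 (θ ↔ π − θ)] [cite: Glazman2015WeightedSAW, Lemma 3.1 (proof)] -/
theorem AJ_mirrorAt_ne_zero (hr : RootedFace D (w.side .W) r) (h : ω.IsB2a) (hA : ω.AJ hr h (toC (midPt (w.side .W))) ≠ 0) :
    ω.mirrorAt.AJ (rootedFace_rowMirrorDom_mirrorRowFace hr) (isB2a_mirrorAt hr h) (toC (midPt (w.side .W))) ≠ 0 := by
  have hr' := rootedFace_rowMirrorDom_mirrorRowFace (w := w) hr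
  have h' := isB2a_mirrorAt hr h
  -- wound ⟺ WE ≠ excursionWinding (at any angle); transport at the angle π − θ with θ := π/2
  have hW : ω.WE (fun _ => π - π / 2) ≠ excursionWinding (π - π / 2) ω.2.firstSideG (ω.z1 hr h) ω.1 :=
    (ω.WE_ne_excursionWinding_iff_AJ_root_ne_zero hr h (π - π / 2)).2 hA
  refine (ω.mirrorAt.WE_ne_excursionWinding_iff_AJ_root_ne_zero hr' h' (π / 2)).1 ?_
  rw [WE_mirrorAt, firstSideG_mirrorAt hr h, z1_mirrorAt hr h, mirrorAt_fst, excursionWinding_mirrorSide]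
  exact fun e => hW (neg_injective e)

/-- ★ **A WOUND WALK DRAWS AN ARC ABOVE THE HOLE ROW, WEST OF THE ROOT**: some plaquette of the walk lies in row `w.2 + 1` and
column `≤ w.1 − 1`. Proof: reflect in the root row; the reflected walk is wound, so its excursion crosses the bottom ray of the
reflected picture an odd number of times — that ray is the TOP line of the hole row. [cite: GlazmanManolescu2019, Lemma 2.1; §4.2 (lattice symmetries)] [cite: CourantRobbins1958, Ch. V Appendix §2 (the even–odd rule)] -/
theorem exists_fc_above_of_wound (hr : RootedFace D (w.side .W) r) (h : ω.IsB2a)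
    (hA : ω.AJ hr h (toC (midPt (w.side .W))) ≠ 0) :
    ∃ i < ω.2.arcs.length, (ω.2.fc i).2 = w.2 + 1 ∧ (ω.2.fc i).1 ≤ w.1 - 1 := by
  have hr' := rootedFace_rowMirrorDom_mirrorRowFace (w := w) hr
  have h' := isB2a_mirrorAt hr h
  have hA' := AJ_mirrorAt_ne_zero hr h hA
  have hodd' := (ω.mirrorAt.AJ_root_ne_zero_iff_odd_rayCountAt (hr := hr') h' (b := w) (τ := .W) rfl).1 hA'
  -- the reflected walk's bottom ray count is the original walk's count on the ray behind the W side of `(w.1, w.2 + 1)`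
  have key := rayCountAt_W_of_mids_mirror (hr := hr) (hr' := hr') ω.mirrorAt_mids h h' ((w.1 : ℤ), (w.2 + 1 : ℤ))
  have ew : (((w.1 : ℤ), (w.2 + 1 : ℤ)).1, 2 * w.2 - ((w.1 : ℤ), (w.2 + 1 : ℤ)).2 + 1) = w := by
    obtain ⟨k, j⟩ := w; simp only [Prod.mk.injEq, true_and]; ring
  rw [ew] at key
  rw [key] at hodd'
  obtain ⟨j, hj, m, he⟩ := ω.exists_exit_eq_rayMid_of_odd hr h hodd'
  rw [rayMid_W_eq] at he
  obtain ⟨-, ⟨i, hi, hf⟩⟩ := ω.exists_fc_row_of_exit_slant hr h hj he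
  exact ⟨i, hi, by rw [hf], by rw [hf]; show w.1 - 1 - (m : ℤ) ≤ w.1 - 1; omega⟩

/-- ★★ **WOUND STRADDLE**: a wound class-`B2a` walk from a hole root draws arcs in plaquettes strictly ABOVE and strictly BELOW
the row of the hole, in columns west of the root — so neither extreme row of the walk is the root row. [cite: GlazmanManolescu2019, Lemma 2.1] [cite: CourantRobbins1958, Ch. V Appendix §2 (the even–odd rule)] -/
theorem wound_straddle (hr : RootedFace D (w.side .W) r) (h : ω.IsB2a) (hA : ω.AJ hr h (toC (midPt (w.side .W))) ≠ 0) :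
    (∃ i < ω.2.arcs.length, (ω.2.fc i).2 = w.2 + 1 ∧ (ω.2.fc i).1 ≤ w.1 - 1) ∧
      (∃ i < ω.2.arcs.length, (ω.2.fc i).2 = w.2 - 1 ∧ (ω.2.fc i).1 ≤ w.1 - 1) :=
  ⟨exists_fc_above_of_wound hr h hA, exists_fc_below_of_wound ω hr h hA⟩

end ΩG

end Literature.Probability.RandomPlanarGeometry.SAW.YangBaxter
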